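import Summits.CriticalPhenomena.PercolationContinuityZ3.Theorems.PercNearOneGluingNoHeavyQuantRootScaledExpansion
import Summits.CriticalPhenomena.PercolationContinuityZ3.Theorems.PercNearOneGluingNoHeavyQuantForestBridge
import HarnessLib

/-!
# QUANT lane R8, T-DEC: THE TOP-LEVEL ROOT-SCALED EXPANSION, part 2 — the product part is FREE (oracle + `convClosedT_holds`), so the sibling
# step for `L` at outer gate `a` REDUCES to "the residual `resid a w L` is DEC at floor `a·x`"; kernel skeleton `SiblingStep ⟸ (I) ∧ (II)`
# (lead g46 README V428 (2)–(3) / V429; arm-1 gen 48)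

builds on p205010 (kernel theorem, internal audit signed; external expert review pending)

Support file (`--supports stmt-CriticalPhenomena-4575`), QUANT lane seat prim-quant-arm-1 (gen 48, architect), rung R8 of
`run/shared/lean/prim/quant/LADDER.md`; memo `run/shared/lean/prim/quant/prim-quant-arm-1-g48/ARCH-G48.md`.  Theorems only (no definitions, no
`@[conjecture]`), standard axioms, no sorries.  Sequel of `…QuantRootScaledExpansion` (`Sib.scale`, `wco`, `resid`, `gate_flaw_eq_mix`, `resid_laws`);
uses typer g39's `…QuantForestBridge` (`Sib.TreeOK`, `fgates`, `compForestN_of_list`, `siblingStep_iff_list`), census-2's `DECAtT` / `decAtT_mixture`,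
and `decAt_lconv_of_convClosedT` + `convClosedT_holds` (this lane).

THE USE OF THE EXPANSION `gate (flaw L) a = w·flaw Lₐ + (1 − w)·resid a w L`.  `flaw Lₐ` is a forest of the SAME sub-forests with smaller root gates:
each `ρᵢ` is SDEC by the ORACLE of the sibling step (its gate count is below `fgates L`), so `flaw Lₐ` is DEC at floor `a·x` at every layer by
`convClosedT_holds` iterated along the list (`decAt_flaw_of_sdec`) — the (P) part is FREE, exactly as in arm-1 g45's two-root step.  Therefore
(`decAt_gate_flaw_of_resid`): **the node's obligation at outer gate `a` — `gate (flaw L) a` DEC at floor `a·x` at every layer below the top — follows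
from the same statement for the ONE explicit law `resid a w L`** (mixture at the common target `a·fmean L`); and (`sdec_flaw_of_resid`,
`siblingStep_of_resid`) the list form of `SiblingStep` follows from the two per-gate claims of README V428 (3): (I) below a threshold `a₁` the gated
forest itself is certified, (II) above it the residual is (`a = 1` is the free product).  Certifying (I)/(II) on families (gated blob hull /
fewer-gate forests; census-2's thresholds `a_* < a*`) is NOT done here.

* `Sib.scale_treeOK`, `map_scale_treeOK`, `fgates_map_scale`, `lt_fgates_of_mem`, `sdec_members_of_oracle`;
* **`decAt_flaw_of_sdec`** (the product part is free), **`decAt_gate_flaw_of_resid`** (the node's obligation at gate `a` from the residual),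
  **`sdec_flaw_of_resid`** (SDEC of the forest from (I) ∧ (II)), **`siblingStep_of_resid`** (`SiblingStep ⟸ (I) ∧ (II)` for all lists).

HONEST STATUS: an exact reduction, not a proof of the node; `SiblingStep`, `GateStepN`, `FarTreeRow` OPEN; RATE class log\* / honest sentence of
`run/shared/lean/prim/quant/README.md` unchanged.  [this work]; programme (I)–(II): prim-quant-lead g46; list binder / bridge: prim-quant-stmt g39.
Nothing here is cited as a published result.  The gluing rows served [cite: KozmaNitzan2024, Conjecture 3 (p. 15)]; product measure
[cite: Grimmett1999, §1.3 p. 10].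
-/

noncomputable section

open scoped BigOperators

namespace Summit.CriticalPhenomena.PercolationContinuityZ3.Theorems
namespace Quant
namespace LawDec

open Finset

/-! ### Root scaling at the tree-built layer -/

/-- root scaling by `0 < a ≤ 1` sends a tree-built sibling at floor `x` to one at floor `a·x`. [this work] -/
theorem Sib.scale_treeOK {x a : ℝ} (ha0 : 0 < a) (ha1 : a ≤ 1) {s : Sib} (hs : s.TreeOK x) : (s.scale a).TreeOK (a * x) := by
  obtain ⟨hq0, hq1, hxq, hT, hnp⟩ := hs
  refine ⟨mul_pos ha0 hq0, ?_, ?_, hT, hnp⟩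
  · show a * s.q < 1
    nlinarith
  · show a * x ≤ a * s.q * s.x₁
    nlinarith [mul_le_mul_of_nonneg_left hxq ha0.le]


/-- members of the scaled list are tree-built at floor `a·x`. [this work] -/
theorem map_scale_treeOK {x a : ℝ} (ha0 : 0 < a) (ha1 : a ≤ 1) (L : List Sib) (hL : ∀ s ∈ L, s.TreeOK x) :
    ∀ s ∈ L.map (Sib.scale a), s.TreeOK (a * x) := by
  intro s hs
  obtain ⟨t, ht, rfl⟩ := List.mem_map.1 hs
  exact Sib.scale_treeOK ha0 ha1 (hL t ht)


/-- root scaling keeps the gate count. [this work] -/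
theorem fgates_map_scale (a : ℝ) (L : List Sib) : fgates (L.map (Sib.scale a)) = fgates L := by
  induction L with
  | nil => rfl
  | cons s L ih => simp only [List.map_cons, fgates, ih]; rfl


/-- the gate count of a member's sub-forest is below the forest's gate count. [this work] -/
theorem lt_fgates_of_mem (L : List Sib) : ∀ s ∈ L, s.n < fgates L := by
  induction L with
  | nil => intro s hs; simp at hs
  | cons t L ih =>
    intro s hs
    simp only [fgates]
    rcases List.mem_cons.1 hs with rfl | hs
    · omega
    · have := ih s hs; omega

/-! ### The product part is free; the DEC and SDEC consequences -/

/-- **THE PRODUCT PART IS FREE**: a forest of tree-built siblings at floor `0 < y < 1` whose sub-forest laws are SDEC at their floors (the oracle of the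
sibling step) is DEC at floor `y` at EVERY layer — `convClosedT_holds` iterated along the list (`decAt_lconv_of_convClosedT`), the top layers by
Theorem A. [this work] -/
theorem decAt_flaw_of_sdec {y : ℝ} (hy0 : 0 < y) (hy1 : y < 1) :
    ∀ L : List Sib, (∀ s ∈ L, s.TreeOK y) → (∀ s ∈ L, SDEC s.x₁ s.M s.ρ) → ∀ j, DECAt y j (ftop L) (flaw L)
  | [], _, _, j => by
    refine decAt_of_top_le 0 (flaw []) (fun h => ?_) (fun h hh => ?_) (by simp [flaw]) y hy1 (fun h hh => ?_) j (Nat.zero_le j)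
    · simp only [flaw]; split_ifs <;> norm_num
    · simp only [flaw]; rw [if_neg (by omega)]
    · simp only [flaw] at hh ⊢
      by_cases h0 : h = 0
      · subst h0; simp
      · rw [if_neg h0] at hh; exact absurd hh (lt_irrefl 0)
  | s :: L, hL, hS, j => by
    have hs := hL s List.mem_cons_self
    have hL' : ∀ t ∈ L, t.TreeOK y := fun t ht => hL t (List.mem_cons_of_mem s ht)
    have hS' : ∀ t ∈ L, SDEC t.x₁ t.M t.ρ := fun t ht => hS t (List.mem_cons_of_mem s ht)
    obtain ⟨hq0, hq1, hxq, hT, _⟩ := hs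
    obtain ⟨_, hx₁1, ρ0, ρM, ρ1, ρta⟩ := hT.lawFacts
    have hqx1 : s.q * s.x₁ < 1 := by nlinarith
    -- the whole forest and the tail are tree-built at `y`
    have hW := (compForestN_of_list hy0 hy1 (s :: L) hL).treeBuiltN
    obtain ⟨_, _, w0, wM, w1, wta⟩ := hW.lawFacts
    have hF := (compForestN_of_list hy0 hy1 L hL').treeBuiltN
    obtain ⟨_, _, f0, fM, f1, fta⟩ := hF.lawFacts
    obtain ⟨g0, gM, g1⟩ := gate_laws s.M s.ρ s.q hq0.le hq1.le ρ0 ρM ρ1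
    have ih : ∀ j', DECAt y j' (ftop L) (flaw L) := decAt_flaw_of_sdec hy0 hy1 L hL' hS'
    have htop : ftop (s :: L) = ftop L + s.M := rfl
    by_cases hj : j < ftop L + s.M
    · rw [htop]
      show DECAt y j (ftop L + s.M) (lconv (ftop L) s.M (flaw L) (gate s.ρ s.q))
      refine decAt_lconv_of_convClosedT convClosedT_holds y (ftop L) s.M (flaw L) (gate s.ρ s.q) hy0 hy1 f0 fM f1 g0 gM g1
        (fun h hh => ?_) (fun h hh => ?_) (fun j' _ => ih j') (fun j' hj' => ?_) j hj
      · have hhM : h ≤ ftop L := by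
          by_contra hlt; exact absurd (fM h (not_le.1 hlt)) (ne_of_gt hh)
        have : y * (h : ℝ) ≤ y * (ftop L : ℝ) := mul_le_mul_of_nonneg_left (by exact_mod_cast hhM) hy0.le
        linarith
      · have hhM : h ≤ s.M := by
          by_contra hlt; exact absurd (gM h (not_le.1 hlt)) (ne_of_gt hh)
        rw [sum_mul_gate]
        have e1 : y * (h : ℝ) ≤ y * (s.M : ℝ) := mul_le_mul_of_nonneg_left (by exact_mod_cast hhM) hy0.le
        have e2 : y * (s.M : ℝ) ≤ s.q * s.x₁ * (s.M : ℝ) := mul_le_mul_of_nonneg_right hxq (Nat.cast_nonneg _)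
        have e3 : s.q * s.x₁ * (s.M : ℝ) ≤ s.q * ∑ k ∈ Finset.range (s.M + 1), (k : ℝ) * s.ρ k := by
          rw [mul_assoc]; exact mul_le_mul_of_nonneg_left ρta hq0.le
        linarith
      · have d := hS s List.mem_cons_self s.q hq0 hq1.le j' hj'
        exact decAt_mono_floor hxq hqx1 d
    · rw [htop]
      exact decAt_of_top_le (ftop L + s.M) (flaw (s :: L)) w0 wM w1 y hy1 (fun h hh => by
        have hhM : h ≤ ftop L + s.M := by
          by_contra hlt; exact absurd (wM h (not_le.1 hlt)) (ne_of_gt hh)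
        have : y * (h : ℝ) ≤ y * ((ftop L + s.M : ℕ) : ℝ) := mul_le_mul_of_nonneg_left (by exact_mod_cast hhM) hy0.le
        rw [htop] at wta
        linarith) j (not_lt.1 hj)

/-- the oracle of the sibling step supplies SDEC of every member's sub-forest law (its gate count is below `fgates L`). [this work] -/
theorem sdec_members_of_oracle {x : ℝ} (L : List Sib) (hL : ∀ s ∈ L, s.TreeOK x)
    (hO : ∀ (x' : ℝ) (n' M' : ℕ) (μ' : ℕ → ℝ), n' < fgates L → TreeBuiltN x' n' M' μ' → SDEC x' M' μ') :
    ∀ s ∈ L, SDEC s.x₁ s.M s.ρ :=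
  fun s hs => hO s.x₁ s.n s.M s.ρ (lt_fgates_of_mem L s hs) (hL s hs).2.2.2.1

/-- **THE NODE'S OBLIGATION AT OUTER GATE `a` FROM THE RESIDUAL ALONE.**  Tree-built siblings at floor `0 < x < 1` with SDEC sub-forest laws (the
oracle), an outer gate `0 < a ≤ 1`, a weight `0 ≤ w ≤ wco a L`, `w < 1`: if the residual `resid a w L` is DEC at floor `a·x` at every layer below the top,
then so is `gate (flaw L) a` — the product part `flaw Lₐ` being DEC at `a·x` for free (`decAt_flaw_of_sdec` on the scaled list) and the two mixed at the
common target `a·fmean L` (`decAtT_mixture`). [this work] -/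
theorem decAt_gate_flaw_of_resid {x a w : ℝ} (hx0 : 0 < x) (hx1 : x < 1) (ha0 : 0 < a) (ha1 : a ≤ 1)
    (L : List Sib) (hL : ∀ s ∈ L, s.TreeOK x) (hρ : ∀ s ∈ L, SDEC s.x₁ s.M s.ρ)
    (hw0 : 0 ≤ w) (hw : w ≤ wco a L) (hw1 : w < 1)
    (hR : ∀ j, j < ftop L → DECAt (a * x) j (ftop L) (resid a w L))
    (j : ℕ) (hj : j < ftop L) : DECAt (a * x) j (ftop L) (gate (flaw L) a) := by
  have hL' : ∀ s ∈ L, s.LawOK := fun s hs => (hL s hs).lawOK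
  have hax0 : 0 < a * x := mul_pos ha0 hx0
  have hax1 : a * x < 1 := by nlinarith
  obtain ⟨f0, fM, f1, fmn⟩ := flaw_facts L hL'
  obtain ⟨_, _, _, famn⟩ := flaw_facts (L.map (Sib.scale a)) (map_scale_lawOK ha0 ha1 L hL')
  rw [ftop_map_scale, fmean_map_scale] at famn
  obtain ⟨_, _, _, rmn⟩ := resid_laws ha0 ha1 L hL' hw hw1
  -- (P): the scaled forest, free
  have hP : DECAtT (a * x) (a * fmean L) j (ftop L) (flaw (L.map (Sib.scale a))) := by
    have d := decAt_flaw_of_sdec hax0 hax1 (L.map (Sib.scale a)) (map_scale_treeOK ha0 ha1 L hL)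
      (fun s hs => by
        obtain ⟨t, ht, rfl⟩ := List.mem_map.1 hs
        exact hρ t ht) j
    rw [ftop_map_scale, decAt_iff_decAtT, famn] at d
    exact d
  -- (R): the residual, by hypothesis
  have hRT : DECAtT (a * x) (a * fmean L) j (ftop L) (resid a w L) := by
    have d := hR j hj
    rw [decAt_iff_decAtT, rmn] at d
    exact d
  have mix := decAtT_mixture w hw0 hw1.le hP hRT
  have e : gate (flaw L) a = fun h => w * flaw (L.map (Sib.scale a)) h + (1 - w) * resid a w L h :=
    funext fun h => gate_flaw_eq_mix a w L hw1 h
  rw [decAt_iff_decAtT, sum_mul_gate, fmn, e]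
  exact mix

/-- **SDEC OF THE FOREST FROM THE TWO PER-GATE CLAIMS (README V428 (3)).**  Tree-built siblings at floor `0 < x < 1` with SDEC sub-forest laws; a
threshold `a₁` and a weight schedule `w`: (I) for outer gates `0 < a ≤ a₁` (`a < 1`) the gated forest `gate (flaw L) a` is DEC at `a·x` at every layer
below the top; (II) for `a₁ < a < 1` the residual `resid a (w a) L` is, with `0 ≤ w a ≤ wco a L`, `w a < 1`.  Then `flaw L` is SDEC at `x` (`a = 1` is
the free product part). [this work] -/
theorem sdec_flaw_of_resid {x : ℝ} (hx0 : 0 < x) (hx1 : x < 1) (L : List Sib) (hL : ∀ s ∈ L, s.TreeOK x)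
    (hρ : ∀ s ∈ L, SDEC s.x₁ s.M s.ρ) (a₁ : ℝ) (w : ℝ → ℝ)
    (hI : ∀ a, 0 < a → a ≤ a₁ → a < 1 → ∀ j, j < ftop L → DECAt (a * x) j (ftop L) (gate (flaw L) a))
    (hw : ∀ a, a₁ < a → a < 1 → 0 ≤ w a ∧ w a ≤ wco a L ∧ w a < 1)
    (hII : ∀ a, a₁ < a → a < 1 → ∀ j, j < ftop L → DECAt (a * x) j (ftop L) (resid a (w a) L)) :
    SDEC x (ftop L) (flaw L) := by
  intro a ha0 ha1 j hj
  rcases eq_or_lt_of_le ha1 with rfl | hlt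
  · rw [gate_one, one_mul]
    exact decAt_flaw_of_sdec hx0 hx1 L hL hρ j
  · by_cases hle : a ≤ a₁
    · exact hI a ha0 hle hlt j hj
    · obtain ⟨hw0, hwle, hw1⟩ := hw a (not_le.1 hle) hlt
      exact decAt_gate_flaw_of_resid hx0 hx1 ha0 ha1 L hL hρ hw0 hwle hw1 (hII a (not_le.1 hle) hlt) j hj

/-- **KERNEL SKELETON `SiblingStep ⟸ (I) ∧ (II)`** (README V428 (2)): if for every forest of `k ≥ 3` tree-built siblings (list binder, under the
oracle of the sibling step) there are a threshold `a₁ L` and weights `w L a` such that (I) the gated forest is certified (DEC at `a·x`, every layer)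
for outer gates `a ≤ a₁ L` and (II) the residual `resid a (w L a) L` is certified for `a₁ L < a < 1`, then `SiblingStep` holds — hence (typer g39's
`…QuantSiblingStep`) `GateStepN`, `SDECConvClosedTB`, `Quant.FarTreeRow`. [this work] -/
theorem siblingStep_of_resid (a₁ : List Sib → ℝ) (w : List Sib → ℝ → ℝ)
    (hI : ∀ (x : ℝ) (L : List Sib), 0 < x → x < 1 → (∀ s ∈ L, s.TreeOK x) → 3 ≤ L.length →
      (∀ (x' : ℝ) (n' M' : ℕ) (μ' : ℕ → ℝ), n' < fgates L → TreeBuiltN x' n' M' μ' → SDEC x' M' μ') →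
      ∀ a, 0 < a → a ≤ a₁ L → a < 1 → ∀ j, j < ftop L → DECAt (a * x) j (ftop L) (gate (flaw L) a))
    (hw : ∀ (L : List Sib) (a : ℝ), a₁ L < a → a < 1 → 0 ≤ w L a ∧ w L a ≤ wco a L ∧ w L a < 1)
    (hII : ∀ (x : ℝ) (L : List Sib), 0 < x → x < 1 → (∀ s ∈ L, s.TreeOK x) → 3 ≤ L.length →
      (∀ (x' : ℝ) (n' M' : ℕ) (μ' : ℕ → ℝ), n' < fgates L → TreeBuiltN x' n' M' μ' → SDEC x' M' μ') →
      ∀ a, a₁ L < a → a < 1 → ∀ j, j < ftop L → DECAt (a * x) j (ftop L) (resid a (w L a) L)) :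
    SiblingStep := by
  rw [siblingStep_iff_list]
  intro x L hx0 hx1 hL hk hO
  exact sdec_flaw_of_resid hx0 hx1 L hL (sdec_members_of_oracle L hL hO) (a₁ L) (w L) (hI x L hx0 hx1 hL hk hO) (hw L)
    (hII x L hx0 hx1 hL hk hO)


end LawDec
end Quant
end Summit.CriticalPhenomena.PercolationContinuityZ3.Theorems
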